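import Summits.QuantumFields.BalabanUV.T4Continuum.Spine.NE5.TwoRunTorusNE5Uniform

/-!
# Spine/NE5/TwoRunTorusNE5AllL — the Lemma-3 witness of the minimal END of row NE5 at EVERY block size `L ≥ L₀`
# (cell `pub-balaban-gaps`, seat `ne5` gen 15; located point (x18) closed on the NE5 side)

WHY.  The final END `TwoRunTorusNE5Final.ne5_end_final` (T49) exports ONE constants record `c` FIRST and its ∀-part
then demands `c.L = L` of the producer's block size `L` (which sits in the TYPES: `TwoTorusStep 4 L (N j)`,
`terms L M Z`).  The only Lemma-3 witness behind that `∃` — r10's `B13Lemma3TorusNonvacuity.consts`, read through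
`numerics_nonvacuous_pos` and T45 `lemma3_witness_allM` — has `c.L = 8`, while print fixes the block size in a DIFFERENT
regime: [I] = CMP 109 p. 251, verbatim *"We take L_μ = L^m, where L is an odd, positive integer > 11"* (typed remarks in
`B13.lean`, `B12.lean`).  So, as typed, NO producer of Bałaban's objects at a printed `L` can invoke the END — located
point (x18) of `HOME/ne/NE5.md` (the same shape of defect as (x15) for the bond-cube side `M`, closed by T45).
THIS FILE closes it on the NE5 side WITHOUT touching r10's file (private lemmas, `c` hidden by an `∃`): §1
`lemma3_witness_transfer` — from ANY record `c` and any `L ≥ c.L`, the record `c′ := {c with L := L, δ := (1 − 2∕L)∕10,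
κ₁ := max c.κ₁ (1 + 36(1 − 7δ′)½Lκ), ε₁ := c.ε₁·e^{C₂(κ₁ − κ₁′)}·t}`, `t := ((c.L+2)∕(L+2))⁴·u`, `u := e^{−¾(L − c.L)κ}`,
satisfies the 41 conjuncts of `numerics_nonvacuous_pos` at rate `a′ := a − 20 log t` whenever `c` does at rate `a`:
R22 by construction (p. 21, the "or"); `ε₂` (p. 19) and `1∕|τ|` ((2.18)) scale by `t ≤ 1`, `(L+2)⁴O(1)ε₂` (p. 20) and
`C₃ε₁` by `u ≤ 1` (§0) — `u` being EXACTLY the growth of `exp 5(1−7δ)½Lκ = exp ¼(3L+14)κ` in the consumed R18; all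
other conjuncts are monotone (T45 `A237_antitone` for the (2.37) letter).  §2 `lemma3_witness_allL`: composed with T45,
`∃ L₀ ≥ 8 ∀ L ≥ L₀ ∃ c, c.L = L ∧ ∀ M ≥ 1 ∃ a, (41 conjuncts)` — ONE record per block size; the threshold form is
print's own (*"> 11"*); `L₀` is r10's `c.L`.  `TwoRunTorusNE5FinalL` re-quantifies the END with `∀ L ≥ L₀` OUTERMOST.
The real letter `c.M` (R24) and the bond-cube side stay separate letters, as in r10's witness and T45 ((x15″)).

HONEST FRAMING.  Witness bookkeeping (field surgery on an opaque record + monotonicity); it certifies only that the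
typed inequality list is CONSISTENT at every `L ≥ L₀`, nothing about the size of Bałaban's constants; nothing of
Bałaban's is constructed or asserted beyond print.  NE5 NOT PRINTED ∕ NOT PROVED; leaves 0∕12; (D4) 0∕1; spine 0∕9.
Rung (B)+1 on a FIXED finite T⁴ — NOT continuum ∕ infinite volume ∕ mass gap ∕ Clay; continuum YM on T⁴ ⇐ BetaPertH ∧
nine spine estimates.  0 sorry, 0 `def`.  Sources: [II] = T. Bałaban, CMP **116** (1988) [Balaban1988RG2Cluster] (2.18)
p. 16, (2.31) p. 18, p. 19 (ε₂), p. 20 (C₃), p. 21; [I] = CMP **109** (1987) [Balaban1987RG1] p. 251, (0.24)–(0.25) p. 257.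
Nothing here is a claim about the Yang–Mills mass gap.
-/

noncomputable section

namespace Summit.QuantumFields.BalabanUV.T4Continuum.Spine.NE5.TwoRunTorusNE5AllL

open Literature.MathematicalPhysics.QuantumFieldTheory.Balaban1983to89
open Literature.MathematicalPhysics.QuantumFieldTheory.Balaban1983to89.B13Bound143 (invTau)
open Literature.MathematicalPhysics.QuantumFieldTheory.Balaban1983to89.B12TreeDecay (kappa₀ K₀ K₀_pos)
open Summit.QuantumFields.BalabanUV.T4Continuum.Spine.NE5.TwoRunTorusNE5Uniform (lemma3_witness_allM A237_antitone)

/-! ## §0. The rate identities of p. 21 at a general block size -/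

/-- With `δ = (1 − 2X⁻¹)∕10` (p. 21, the "or" of R22): `(1 − 10δ)½X = 1`, `(1 − 7δ)½X = (3X + 14)∕20`,
`(1 − 8δ)½X = (X + 8)∕10`, `δ·½X = (X − 2)∕20`. [cite: Balaban1988RG2Cluster, p.21 (after (2.41))] -/
theorem delta_identities {X : ℝ} (hX : X ≠ 0) :
    (1 - 10 * ((1 - 2 / X) / 10)) * (X / 2) = 1 ∧ (1 - 7 * ((1 - 2 / X) / 10)) * (X / 2) = (3 * X + 14) / 20 ∧
    (1 - 8 * ((1 - 2 / X) / 10)) * (X / 2) = (X + 8) / 10 ∧ (1 - 2 / X) / 10 * (X / 2) = (X - 2) / 20 := by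
  refine ⟨?_, ?_, ?_, ?_⟩ <;> field_simp <;> ring
/-- The p. 19 product `ε₂ = 2E₀ε₁C₁α₄⁻¹α₆⁻¹M^q e^{C₂κ₁}` after the field surgery `L, δ, κ₁ ↦ L′, δ′, κ₁′`,
`ε₁ ↦ ε₁·e^{C₂(κ₁ − κ₁′)}·t`: it is multiplied by `t` (the `e^{C₂κ₁}`'s cancel). [cite: Balaban1988RG2Cluster, p.19 (definition of ε₂)] -/
theorem eps2_transfer (c : B13.Consts) (L' : ℕ) (δ' κ₁' t : ℝ) :
    ({ c with L := L', δ := δ', κ₁ := κ₁', ε₁ := c.ε₁ * Real.exp (c.C₂ * (c.κ₁ - κ₁')) * t } : B13.Consts).eps2 =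
      t * c.eps2 := by
  have hexp : Real.exp (c.C₂ * (c.κ₁ - κ₁')) * Real.exp (c.C₂ * κ₁') = Real.exp (c.C₂ * c.κ₁) := by
    rw [← Real.exp_add]; ring_nf
  simp only [B13.Consts.eps2, B13.Consts.K₀]
  linear_combination (c.E₀ * c.ε₁ * t * (2 * c.C₁ * c.α₄⁻¹ * c.α₆⁻¹ * c.M ^ c.q)) * hexp

/-- The (2.18) radius `1∕|τ(Y)| = E₀ε₁C₁α₄⁻¹M^q e^{C₂κ₁} e^{−(1−3δ)κd}` after the same surgery: `t` times the `d = 0`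
value of the old record times the new decay factor. [cite: Balaban1988RG2Cluster, (2.18) p.16] -/
theorem invTau_transfer (c : B13.Consts) (L' : ℕ) (δ' κ₁' t d : ℝ) :
    invTau ({ c with L := L', δ := δ', κ₁ := κ₁', ε₁ := c.ε₁ * Real.exp (c.C₂ * (c.κ₁ - κ₁')) * t } : B13.Consts) d =
      t * invTau c 0 * Real.exp (-(1 - 3 * δ') * c.κ * d) := by
  have hexp : Real.exp (c.C₂ * (c.κ₁ - κ₁')) * Real.exp (c.C₂ * κ₁') = Real.exp (c.C₂ * c.κ₁) := by
    rw [← Real.exp_add]; ring_nf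
  simp only [invTau, mul_zero, Real.exp_zero, mul_one]
  linear_combination (c.E₀ * c.ε₁ * t * c.C₁ * c.α₄⁻¹ * c.M ^ c.q * Real.exp (-(1 - 3 * δ') * c.κ * d)) * hexp

/-- The per-member constant `(L+2)⁴·A·ε₂` of p. 20 after the surgery with `t = ((c.L+2)∕(L′+2))⁴·u`: it is multiplied
by `u`. [cite: Balaban1988RG2Cluster, p.20 (before (2.37))] -/
theorem memberF_transfer (c : B13.Consts) (L' : ℕ) (δ' κ₁' u : ℝ) (A : ℝ) :
    B13Step237.memberF
        ({ c with
            L := L', δ := δ', κ₁ := κ₁',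
            ε₁ := c.ε₁ * Real.exp (c.C₂ * (c.κ₁ - κ₁')) *
              (((c.L : ℝ) + 2) ^ 4 / ((L' : ℝ) + 2) ^ 4 * u) } : B13.Consts) A =
      u * B13Step237.memberF c A := by
  have hL : ((L' : ℝ) + 2) ^ 4 ≠ 0 := by positivity
  unfold B13Step237.memberF
  rw [eps2_transfer]
  show ((L' : ℝ) + 2) ^ 4 * A * (((c.L : ℝ) + 2) ^ 4 / ((L' : ℝ) + 2) ^ 4 * u * c.eps2) =
    u * (((c.L : ℝ) + 2) ^ 4 * A * c.eps2)
  field_simp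

/-- `C₃ε₁ = 2(L+2)⁴O(1)ε₂` (p. 20) after the same surgery: multiplied by `u`. [cite: Balaban1988RG2Cluster, p.20 (definition of C₃)] -/
theorem C3eps_transfer (c : B13.Consts) (L' : ℕ) (δ' κ₁' u : ℝ) :
    ({ c with
        L := L', δ := δ', κ₁ := κ₁',
        ε₁ := c.ε₁ * Real.exp (c.C₂ * (c.κ₁ - κ₁')) *
          (((c.L : ℝ) + 2) ^ 4 / ((L' : ℝ) + 2) ^ 4 * u) } : B13.Consts).C3act *
      ({ c with
        L := L', δ := δ', κ₁ := κ₁',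
        ε₁ := c.ε₁ * Real.exp (c.C₂ * (c.κ₁ - κ₁')) *
          (((c.L : ℝ) + 2) ^ 4 / ((L' : ℝ) + 2) ^ 4 * u) } : B13.Consts).ε₁ =
      u * (c.C3act * c.ε₁) := by
  rw [← B13Step237.bracketF_A1, ← B13Step237.bracketF_A1]
  unfold B13Step237.bracketF
  rw [memberF_transfer]
  show 2 * (u * B13Step237.memberF c c.A₁) = u * (2 * B13Step237.memberF c c.A₁)
  ring

/-! ## §1. The transfer of the 41 conjuncts from `c.L` to any `L ≥ c.L` -/

/-- **THE LEMMA-3 WITNESS TRANSFERRED TO A LARGER BLOCK SIZE.**  For every record `c` and every `L ≥ c.L` there is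
a record `c′` with `c′.L = L` (the surgery of the module docstring) such that WHENEVER `c` satisfies the 41 conjuncts of
r10's `numerics_nonvacuous_pos` (R15–R18, R20, R22–R24, the smallness of (2.29) ∕ (2.31), the O(1) of (2.37) ∕ (2.38) ∕
(2.41), the ½E₀ bookkeeping, `a₅ > 0`, `κ₁ ≥ 1`, the (2.18) clause) at bond-cube side `M` and rate `a`, then `c′`
satisfies them VERBATIM at the same `M, a₂, a₂′, a₅, Aabs, Bc` and the rate `a′ = a − 20 log t ≥ a`.
[cite: Balaban1988RG2Cluster, p.21 (closing paragraph: "The assumptions allow finally us to fix all the constants"), p.20 (before (2.37)), (2.18) p.16, (2.31) p.18] -/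
theorem lemma3_witness_transfer (c : B13.Consts) {L : ℕ} (hLL : c.L ≤ L) :
    ∃ c' : B13.Consts, c'.L = L ∧ c'.κ = c.κ ∧ c'.A₂ = c.A₂ ∧
      ∀ {M : ℕ} {a a₂ a₂' a₅ Aabs Bc : ℝ},
      (8 ≤ c.L ∧ 0 < M ∧ 0 < c.ε₁ ∧ 0 < c.α₆ ∧ 0 ≤ c.eps2 ∧ 0 ≤ c.δ ∧ 0 ≤ 1 - 7 * c.δ ∧ 0 ≤ c.κ ∧ 0 ≤ a ∧
      c.R15 ∧ 18 * ((1 - 4 * c.δ) * c.κ) ≤ a / 20 ∧ 4 * c.κ ≤ a / 20 ∧ Real.exp (-(a / 20)) ≤ c.eps2 ∧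
      2 * (4 : ℝ) * (M : ℝ) ^ 4 * Real.exp (-(a / 10)) ≤ a / 20 ∧
      0 ≤ a₂ ∧ kappa₀ 64 8 + a₂ ≤ c.δ * c.κ ∧ c.α₆ * Real.exp a₂ * K₀ 64 8 * 64 ≤ a₂ ∧
      Real.exp (-(a / 20)) * 64 ≤ c.δ * c.κ ∧
      B13Step237.R18half c (K₀ 64 8 * Real.exp (Real.exp (-(a / 20)) * 64)) ∧
      B13Step237.R18sharp c (K₀ 64 8 * Real.exp (Real.exp (-(a / 20)) * 64)) ((c.L : ℝ) / 2) ∧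
      0 ≤ a₂' ∧ kappa₀ 64 8 + a₂' ≤ c.δ * ((c.L : ℝ) / 2) * c.κ ∧ c.α₆ * Real.exp a₂' * K₀ 64 8 * 64 ≤ a₂' ∧
      18 * ((1 - 7 * c.δ) * ((c.L : ℝ) / 2) * c.κ) ≤ (c.κ₁ - 1) / 2 ∧
      0 ≤ a₅ ∧ a₅ + Real.exp (-((c.κ₁ - 1) / 2)) ≤ Aabs ∧ Aabs * 64 ≤ c.δ * ((c.L : ℝ) / 2) * c.κ ∧
      B13Step237.bracketF c (K₀ 64 8 * Real.exp (Real.exp (-(a / 20)) * 64)) / c.α₆ * Real.exp (Aabs * 64) ≤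
        c.C3act * c.ε₁ ∧
      0 ≤ c.C3act * c.ε₁ ∧ c.κ + 2 * (64 * Real.log 162) + 2 ≤ (1 - 8 * c.δ) * ((c.L : ℝ) / 2) * c.κ ∧
      c.C3act * c.ε₁ * Real.exp (5 * c.κ + 1) * K₀ 64 8 * 9 * 64 ≤ 1 ∧
      Real.exp 1 * 9 * 64 * K₀ 64 8 ^ 2 ≤ c.A₂ ∧ c.R22 ∧ c.R23 ∧ c.R24sharp ∧ 0 ≤ c.E₀ ∧
      0 ≤ Bc ∧ Bc * 64 ≤ c.E₀ / 2 ∧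
      0 < a₅ ∧ 1 ≤ c.κ₁ ∧
      (∀ d : ℝ, 0 ≤ d → 0 < invTau c d ∧ invTau c d ≤ 1 / 2)) →
      ∃ a' : ℝ,
      8 ≤ c'.L ∧ 0 < M ∧ 0 < c'.ε₁ ∧ 0 < c'.α₆ ∧ 0 ≤ c'.eps2 ∧ 0 ≤ c'.δ ∧ 0 ≤ 1 - 7 * c'.δ ∧ 0 ≤ c'.κ ∧ 0 ≤ a' ∧
      c'.R15 ∧ 18 * ((1 - 4 * c'.δ) * c'.κ) ≤ a' / 20 ∧ 4 * c'.κ ≤ a' / 20 ∧ Real.exp (-(a' / 20)) ≤ c'.eps2 ∧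
      2 * (4 : ℝ) * (M : ℝ) ^ 4 * Real.exp (-(a' / 10)) ≤ a' / 20 ∧
      0 ≤ a₂ ∧ kappa₀ 64 8 + a₂ ≤ c'.δ * c'.κ ∧ c'.α₆ * Real.exp a₂ * K₀ 64 8 * 64 ≤ a₂ ∧
      Real.exp (-(a' / 20)) * 64 ≤ c'.δ * c'.κ ∧
      B13Step237.R18half c' (K₀ 64 8 * Real.exp (Real.exp (-(a' / 20)) * 64)) ∧
      B13Step237.R18sharp c' (K₀ 64 8 * Real.exp (Real.exp (-(a' / 20)) * 64)) ((c'.L : ℝ) / 2) ∧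
      0 ≤ a₂' ∧ kappa₀ 64 8 + a₂' ≤ c'.δ * ((c'.L : ℝ) / 2) * c'.κ ∧ c'.α₆ * Real.exp a₂' * K₀ 64 8 * 64 ≤ a₂' ∧
      18 * ((1 - 7 * c'.δ) * ((c'.L : ℝ) / 2) * c'.κ) ≤ (c'.κ₁ - 1) / 2 ∧
      0 ≤ a₅ ∧ a₅ + Real.exp (-((c'.κ₁ - 1) / 2)) ≤ Aabs ∧ Aabs * 64 ≤ c'.δ * ((c'.L : ℝ) / 2) * c'.κ ∧
      B13Step237.bracketF c' (K₀ 64 8 * Real.exp (Real.exp (-(a' / 20)) * 64)) / c'.α₆ * Real.exp (Aabs * 64) ≤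
        c'.C3act * c'.ε₁ ∧
      0 ≤ c'.C3act * c'.ε₁ ∧ c'.κ + 2 * (64 * Real.log 162) + 2 ≤ (1 - 8 * c'.δ) * ((c'.L : ℝ) / 2) * c'.κ ∧
      c'.C3act * c'.ε₁ * Real.exp (5 * c'.κ + 1) * K₀ 64 8 * 9 * 64 ≤ 1 ∧
      Real.exp 1 * 9 * 64 * K₀ 64 8 ^ 2 ≤ c'.A₂ ∧ c'.R22 ∧ c'.R23 ∧ c'.R24sharp ∧ 0 ≤ c'.E₀ ∧
      0 ≤ Bc ∧ Bc * 64 ≤ c'.E₀ / 2 ∧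
      0 < a₅ ∧ 1 ≤ c'.κ₁ ∧
      (∀ d : ℝ, 0 ≤ d → 0 < invTau c' d ∧ invTau c' d ≤ 1 / 2) := by
  -- the new `δ`, `κ₁`, the scaling factors and the new record: terms in `c` and `L` alone (generalized)
  obtain ⟨δL, hδL⟩ : ∃ x : ℝ, x = (1 - 2 / (L : ℝ)) / 10 := ⟨_, rfl⟩
  obtain ⟨κ₁', hκ₁'⟩ : ∃ x : ℝ, x = max c.κ₁ (1 + 36 * ((1 - 7 * δL) * ((L : ℝ) / 2) * c.κ)) := ⟨_, rfl⟩
  obtain ⟨u, hu⟩ : ∃ x : ℝ, x = Real.exp (-(3 / 4 * ((L : ℝ) - c.L) * c.κ)) := ⟨_, rfl⟩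
  obtain ⟨c', hc'⟩ : ∃ c' : B13.Consts, c' =
      { c with
        L := L, δ := δL, κ₁ := κ₁',
        ε₁ := c.ε₁ * Real.exp (c.C₂ * (c.κ₁ - κ₁')) * (((c.L : ℝ) + 2) ^ 4 / ((L : ℝ) + 2) ^ 4 * u) } :=
    ⟨_, rfl⟩
  obtain ⟨t, ht⟩ : ∃ x : ℝ, x = ((c.L : ℝ) + 2) ^ 4 / ((L : ℝ) + 2) ^ 4 * u := ⟨_, rfl⟩
  obtain ⟨pL, pδ, pκ₁, pε₁, pκ, pα₆, pA₂, pE₀, pδ₀, pM⟩ : c'.L = L ∧ c'.δ = δL ∧ c'.κ₁ = κ₁' ∧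
      c'.ε₁ = c.ε₁ * Real.exp (c.C₂ * (c.κ₁ - κ₁')) * t ∧ c'.κ = c.κ ∧ c'.α₆ = c.α₆ ∧ c'.A₂ = c.A₂ ∧
      c'.E₀ = c.E₀ ∧ c'.δ₀ = c.δ₀ ∧ c'.M = c.M := by
    subst hc' ht; exact ⟨rfl, rfl, rfl, rfl, rfl, rfl, rfl, rfl, rfl, rfl⟩
  -- the four transfer identities of §0, read for `c'`
  have keps2 : c'.eps2 = t * c.eps2 := by rw [hc', ht]; exact eps2_transfer c L δL κ₁' _
  have kτ : ∀ d, invTau c' d = t * invTau c 0 * Real.exp (-(1 - 3 * δL) * c.κ * d) := by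
    intro d; rw [hc', ht]; exact invTau_transfer c L δL κ₁' _ d
  have kmem : ∀ A, B13Step237.memberF c' A = u * B13Step237.memberF c A := by
    intro A; rw [hc']; exact memberF_transfer c L δL κ₁' u A
  have kbr : ∀ A, B13Step237.bracketF c' A = u * B13Step237.bracketF c A := fun A => by
    unfold B13Step237.bracketF; rw [kmem]; ring
  have kC3 : c'.C3act * c'.ε₁ = u * (c.C3act * c.ε₁) := by rw [hc']; exact C3eps_transfer c L δL κ₁' u
  clear hc'
  refine ⟨c', pL, pκ, pA₂, ?_⟩
  intro M a a₂ a₂' a₅ Aabs Bc h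
  obtain ⟨hL, hMb, hε₁, hα₆, hε₀, hδ, hδ7, hκc, ha, hR15, hR16, hR16', hR17, h231, ha₂, hκ229, hsm229, habsk,
    h18half, h18, ha₂', hκ229', hsm229', hR20, ha₅0, habs, hAc, hC3, hAct, hlarge, hsmall41, hA₂, hR22, hR23, hR24,
    hE₀, hBc, hBcE, ha₅, hκ₁, hτ⟩ := h
  have hcL8 : (8 : ℝ) ≤ (c.L : ℝ) := by exact_mod_cast hL
  have hcL0 : (0 : ℝ) < (c.L : ℝ) := by linarith only [hcL8]
  have hLr : (c.L : ℝ) ≤ (L : ℝ) := by exact_mod_cast hLL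
  have hL0 : (0 : ℝ) < (L : ℝ) := by linarith only [hcL8, hLr]
  have hL8 : 8 ≤ L := hL.trans hLL
  have hδeq : c.δ = (1 - 2 / (c.L : ℝ)) / 10 := (B13.Consts.R22_iff_delta c hcL0.ne').1 hR22
  obtain ⟨I10L, I7L, I8L, IδL⟩ := delta_identities hL0.ne'
  obtain ⟨-, I7c, I8c, Iδc⟩ := delta_identities hcL0.ne'
  rw [← hδeq] at I7c I8c Iδc
  rw [← hδL] at I10L I7L I8L IδL
  have h2L : 2 / (L : ℝ) ≤ 2 / (c.L : ℝ) := div_le_div_of_nonneg_left (by norm_num) hcL0 hLr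
  have hδδ : c.δ ≤ δL := by rw [hδeq, hδL]; linarith only [h2L]
  have h2L1 : 2 / (L : ℝ) ≤ 1 / 4 := by
    rw [div_le_iff₀ hL0]; have : (8 : ℝ) ≤ L := hcL8.trans hLr; linarith only [this]
  have h2L0 : 0 ≤ 2 / (L : ℝ) := by positivity
  have hδL0 : 0 ≤ δL := by rw [hδL]; linarith only [h2L1, h2L0]
  have hδL1 : δL ≤ 1 / 10 := by rw [hδL]; linarith only [h2L1, h2L0]
  have hδhalf : c.δ * ((c.L : ℝ) / 2) * c.κ ≤ δL * ((L : ℝ) / 2) * c.κ := by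
    rw [Iδc, IδL]; exact mul_le_mul_of_nonneg_right (by linarith only [hLr]) hκc
  have h8half : (1 - 8 * c.δ) * ((c.L : ℝ) / 2) * c.κ ≤ (1 - 8 * δL) * ((L : ℝ) / 2) * c.κ := by
    rw [I8c, I8L]; exact mul_le_mul_of_nonneg_right (by linarith only [hLr]) hκc
  have hu0 : 0 < u := by rw [hu]; exact Real.exp_pos _
  have hu1 : u ≤ 1 := by
    rw [hu]; apply Real.exp_le_one_iff.2
    have : 0 ≤ 3 / 4 * ((L : ℝ) - c.L) * c.κ := mul_nonneg (by linarith only [hLr]) hκc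
    linarith only [this]
  have hs0 : 0 < ((c.L : ℝ) + 2) ^ 4 / ((L : ℝ) + 2) ^ 4 := by positivity
  have hs1 : ((c.L : ℝ) + 2) ^ 4 / ((L : ℝ) + 2) ^ 4 ≤ 1 := by
    rw [div_le_one (by positivity)]
    exact pow_le_pow_left₀ (by linarith only [hcL8]) (by linarith only [hLr]) 4
  have ht0 : 0 < t := by rw [ht]; exact mul_pos hs0 hu0
  have ht1 : t ≤ 1 := by rw [ht, ← one_mul (1 : ℝ)]; exact mul_le_mul hs1 hu1 hu0.le zero_le_one
  -- the new rate `a' = a − 20 log t ≥ a`, with `e^{−a'∕20} = t·e^{−a∕20}`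
  have hlogt : Real.log t ≤ 0 := Real.log_nonpos ht0.le ht1
  obtain ⟨a', ha'⟩ : ∃ x : ℝ, x = a - 20 * Real.log t := ⟨_, rfl⟩
  have haa : a ≤ a' := by rw [ha']; linarith only [hlogt]
  have ha'0 : 0 ≤ a' := ha.trans haa
  have h20 : a / 20 ≤ a' / 20 := by linarith only [haa]
  have hexp' : Real.exp (-(a' / 20)) = t * Real.exp (-(a / 20)) := by
    rw [ha', show -((a - 20 * Real.log t) / 20) = -(a / 20) + Real.log t by ring, Real.exp_add,
      Real.exp_log ht0, mul_comm]
  have hexp_le : Real.exp (-(a' / 20)) ≤ Real.exp (-(a / 20)) := Real.exp_le_exp.2 (by linarith only [haa])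
  have hexp10 : Real.exp (-(a' / 10)) ≤ Real.exp (-(a / 10)) := Real.exp_le_exp.2 (by linarith only [haa])
  -- the (2.37) letter at the two rates, and the monotone constants built on it
  have hA := A237_antitone haa
  have hA0 : 0 ≤ K₀ 64 8 * Real.exp (Real.exp (-(a' / 20)) * 64) := mul_nonneg (K₀_pos 64 8).le (Real.exp_pos _).le
  have hcL2 : 0 ≤ ((c.L : ℝ) + 2) ^ 4 := by positivity
  have hmem0 : 0 ≤ B13Step237.memberF c (K₀ 64 8 * Real.exp (Real.exp (-(a' / 20)) * 64)) := by
    unfold B13Step237.memberF; exact mul_nonneg (mul_nonneg hcL2 hA0) hε₀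
  have hmem : B13Step237.memberF c (K₀ 64 8 * Real.exp (Real.exp (-(a' / 20)) * 64)) ≤
      B13Step237.memberF c (K₀ 64 8 * Real.exp (Real.exp (-(a / 20)) * 64)) := by
    unfold B13Step237.memberF; exact mul_le_mul_of_nonneg_right (mul_le_mul_of_nonneg_left hA hcL2) hε₀
  have hbr0 : 0 ≤ B13Step237.bracketF c (K₀ 64 8 * Real.exp (Real.exp (-(a' / 20)) * 64)) := by
    unfold B13Step237.bracketF; linarith only [hmem0]
  have hbr : B13Step237.bracketF c (K₀ 64 8 * Real.exp (Real.exp (-(a' / 20)) * 64)) ≤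
      B13Step237.bracketF c (K₀ 64 8 * Real.exp (Real.exp (-(a / 20)) * 64)) := by
    unfold B13Step237.bracketF; linarith only [hmem]
  have hκ₁le : c.κ₁ ≤ κ₁' := by rw [hκ₁']; exact le_max_left _ _
  have hκ₁R20 : 1 + 36 * ((1 - 7 * δL) * ((L : ℝ) / 2) * c.κ) ≤ κ₁' := by rw [hκ₁']; exact le_max_right _ _
  obtain ⟨hP0, hP2⟩ := hτ 0 le_rfl
  have hA₂0 : 0 ≤ c.A₂ := le_trans (by positivity) hA₂
  refine ⟨a', ?_, hMb, ?_, ?_, ?_, (by rw [pδ]; exact hδL0), (by rw [pδ]; linarith only [hδL1]), ?_, ha'0, ?_, ?_, ?_, ?_, ?_, ha₂, ?_, ?_, ?_, ?_, ?_, ha₂',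
    ?_, ?_, ?_, ha₅0, ?_, ?_, ?_, ?_, ?_, ?_, ?_, ?_, ?_, ?_, ?_, hBc, ?_, ha₅, ?_, ?_⟩
  · rw [pL]; exact hL8
  · rw [pε₁]; exact mul_pos (mul_pos hε₁ (Real.exp_pos _)) ht0
  · rw [pα₆]; exact hα₆
  · rw [keps2]; exact mul_nonneg ht0.le hε₀
  · rw [pκ]; exact hκc
  · -- R15: `ε₂' e^{5κ} = t·(ε₂ e^{5κ}) ≤ t ≤ 1`
    unfold B13.Consts.R15 at hR15 ⊢
    rw [keps2, pκ, mul_assoc]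
    calc t * (c.eps2 * Real.exp (5 * c.κ)) ≤ 1 * 1 := mul_le_mul ht1 hR15 (by positivity) zero_le_one
      _ = 1 := one_mul 1
  · -- the torus R16: `18(1 − 4δ')κ ≤ 18(1 − 4δ)κ ≤ a∕20 ≤ a'∕20`
    rw [pδ, pκ]
    have : (1 - 4 * δL) * c.κ ≤ (1 - 4 * c.δ) * c.κ := mul_le_mul_of_nonneg_right (by linarith only [hδδ]) hκc
    linarith only [this, hR16, h20]
  · rw [pκ]; exact hR16'.trans h20
  · -- R17: `e^{−a'∕20} = t e^{−a∕20} ≤ t ε₂ = ε₂'`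
    rw [hexp', keps2]; exact mul_le_mul_of_nonneg_left hR17 ht0.le
  · -- the (2.31) count, monotone in the rate
    have hM4 : 0 ≤ 2 * (4 : ℝ) * (M : ℝ) ^ 4 := by positivity
    calc 2 * (4 : ℝ) * (M : ℝ) ^ 4 * Real.exp (-(a' / 10)) ≤ 2 * (4 : ℝ) * (M : ℝ) ^ 4 * Real.exp (-(a / 10)) :=
        mul_le_mul_of_nonneg_left hexp10 hM4
      _ ≤ a / 20 := h231
      _ ≤ a' / 20 := h20
  · -- (2.29): `κ₀ + a₂ ≤ δκ ≤ δ'κ`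
    rw [pδ, pκ]; exact hκ229.trans (mul_le_mul_of_nonneg_right hδδ hκc)
  · rw [pα₆]; exact hsm229
  · -- `64 e^{−a'∕20} ≤ 64 e^{−a∕20} ≤ δκ ≤ δ'κ`
    rw [pδ, pκ]
    exact ((mul_le_mul_of_nonneg_right hexp_le (by norm_num)).trans habsk).trans
      (mul_le_mul_of_nonneg_right hδδ hκc)
  · -- R18 half: `memberF c' A(a') = u·memberF c A(a') ≤ memberF c A(a) ≤ ½`
    unfold B13Step237.R18half at h18half ⊢
    rw [kmem]
    calc u * B13Step237.memberF c (K₀ 64 8 * Real.exp (Real.exp (-(a' / 20)) * 64))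
        ≤ 1 * B13Step237.memberF c (K₀ 64 8 * Real.exp (Real.exp (-(a' / 20)) * 64)) :=
          mul_le_mul_of_nonneg_right hu1 hmem0
      _ ≤ 1 / 2 := by rw [one_mul]; exact hmem.trans h18half
  · -- R18 sharp: the exponent `5(1−7δ')½L'κ = 5(1−7δ)½Lκ + ¾(L'−L)κ` is absorbed by `u`
    unfold B13Step237.R18sharp at h18 ⊢
    rw [kbr, pδ, pL, pκ, pα₆]
    have hsplit : Real.exp (5 * ((1 - 7 * δL) * ((L : ℝ) / 2) * c.κ)) =
        Real.exp (3 / 4 * ((L : ℝ) - c.L) * c.κ) * Real.exp (5 * ((1 - 7 * c.δ) * ((c.L : ℝ) / 2) * c.κ)) := by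
      rw [← Real.exp_add, I7L, I7c]; congr 1; ring
    have hu' : u * Real.exp (3 / 4 * ((L : ℝ) - c.L) * c.κ) = 1 := by
      rw [hu, ← Real.exp_add, neg_add_cancel, Real.exp_zero]
    calc u * B13Step237.bracketF c (K₀ 64 8 * Real.exp (Real.exp (-(a' / 20)) * 64)) *
          Real.exp (5 * ((1 - 7 * δL) * ((L : ℝ) / 2) * c.κ))
        = (u * Real.exp (3 / 4 * ((L : ℝ) - c.L) * c.κ)) *
            (B13Step237.bracketF c (K₀ 64 8 * Real.exp (Real.exp (-(a' / 20)) * 64)) *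
              Real.exp (5 * ((1 - 7 * c.δ) * ((c.L : ℝ) / 2) * c.κ))) := by rw [hsplit]; ring
      _ = B13Step237.bracketF c (K₀ 64 8 * Real.exp (Real.exp (-(a' / 20)) * 64)) *
              Real.exp (5 * ((1 - 7 * c.δ) * ((c.L : ℝ) / 2) * c.κ)) := by rw [hu', one_mul]
      _ ≤ B13Step237.bracketF c (K₀ 64 8 * Real.exp (Real.exp (-(a / 20)) * 64)) *
              Real.exp (5 * ((1 - 7 * c.δ) * ((c.L : ℝ) / 2) * c.κ)) :=
          mul_le_mul_of_nonneg_right hbr (Real.exp_pos _).le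
      _ ≤ c.α₆ := h18
  · -- (2.29) at the next scale: `κ₀ + a₂' ≤ δ½Lκ ≤ δ'½L'κ`
    rw [pδ, pL, pκ]; exact hκ229'.trans hδhalf
  · rw [pα₆]; exact hsm229'
  · -- R20 by the choice of `κ₁'`
    rw [pδ, pL, pκ, pκ₁]; linarith only [hκ₁R20]
  · -- `a₅ + e^{−(κ₁'−1)∕2} ≤ a₅ + e^{−(κ₁−1)∕2} ≤ Aabs`
    rw [pκ₁]
    have : Real.exp (-((κ₁' - 1) / 2)) ≤ Real.exp (-((c.κ₁ - 1) / 2)) := by rw [Real.exp_le_exp]; linarith only [hκ₁le]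
    linarith only [this, habs]
  · rw [pδ, pL, pκ]; exact hAc.trans hδhalf
  · -- the O(1) of C₃: both sides scale by `u`, the letter is antitone
    rw [kbr, kC3, pα₆]
    have h1 : u * B13Step237.bracketF c (K₀ 64 8 * Real.exp (Real.exp (-(a' / 20)) * 64)) / c.α₆ *
        Real.exp (Aabs * 64) =
        u * (B13Step237.bracketF c (K₀ 64 8 * Real.exp (Real.exp (-(a' / 20)) * 64)) / c.α₆ *
          Real.exp (Aabs * 64)) := by ring
    rw [h1]
    refine mul_le_mul_of_nonneg_left ?_ hu0.le
    exact (mul_le_mul_of_nonneg_right (div_le_div_of_nonneg_right hbr hα₆.le) (Real.exp_pos _).le).trans hC3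
  · rw [kC3]; exact mul_nonneg hu0.le hAct
  · -- `κ + 2κ₀ + 2 ≤ (1−8δ)½Lκ ≤ (1−8δ')½L'κ`
    rw [pδ, pL, pκ]; exact hlarge.trans h8half
  · -- the smallness of (2.41): `C₃'ε₁' = u·C₃ε₁`, `u ≤ 1`
    rw [kC3, pκ]
    have h0 : 0 ≤ c.C3act * c.ε₁ * Real.exp (5 * c.κ + 1) * K₀ 64 8 * 9 * 64 :=
      mul_nonneg (mul_nonneg (mul_nonneg (mul_nonneg hAct (Real.exp_pos _).le) (K₀_pos 64 8).le)
        (by norm_num)) (by norm_num)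
    calc u * (c.C3act * c.ε₁) * Real.exp (5 * c.κ + 1) * K₀ 64 8 * 9 * 64
        = u * (c.C3act * c.ε₁ * Real.exp (5 * c.κ + 1) * K₀ 64 8 * 9 * 64) := by ring
      _ ≤ 1 * (c.C3act * c.ε₁ * Real.exp (5 * c.κ + 1) * K₀ 64 8 * 9 * 64) := mul_le_mul_of_nonneg_right hu1 h0
      _ ≤ 1 := by rw [one_mul]; exact hsmall41
  · rw [pA₂]; exact hA₂
  · -- R22 by construction: `(1 − 10δ')½L' = 1`
    unfold B13.Consts.R22; rw [pδ, pL]; exact I10L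
  · -- R23: `A₂·C₃'ε₁' = u·(A₂C₃ε₁) ≤ u·½E₀ ≤ ½E₀`
    unfold B13.Consts.R23 at hR23 ⊢
    rw [pA₂, pE₀, mul_assoc, kC3]
    have h0 : 0 ≤ c.A₂ * c.C3act * c.ε₁ := by rw [mul_assoc]; exact mul_nonneg hA₂0 hAct
    calc c.A₂ * (u * (c.C3act * c.ε₁)) = u * (c.A₂ * c.C3act * c.ε₁) := by ring
      _ ≤ 1 * (c.A₂ * c.C3act * c.ε₁) := mul_le_mul_of_nonneg_right hu1 h0
      _ ≤ c.E₀ / 2 := by rw [one_mul]; exact hR23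
  · unfold B13.Consts.R24sharp at hR24 ⊢; rw [pκ, pδ₀, pM]; exact hR24
  · rw [pE₀]; exact hE₀
  · rw [pE₀]; exact hBcE
  · rw [pκ₁]; exact hκ₁.trans hκ₁le
  · -- the (2.18) clause: `1∕|τ'|(d) = t · (1∕|τ|(0)) · e^{−(1−3δ')κd} ∈ (0, ½]`
    intro d hd
    rw [kτ]
    have hdec : Real.exp (-(1 - 3 * δL) * c.κ * d) ≤ 1 := by
      apply Real.exp_le_one_iff.2
      have : 0 ≤ (1 - 3 * δL) * c.κ * d := mul_nonneg (mul_nonneg (by linarith only [hδL1]) hκc) hd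
      linarith only [this]
    refine ⟨mul_pos (mul_pos ht0 hP0) (Real.exp_pos _), ?_⟩
    calc t * invTau c 0 * Real.exp (-(1 - 3 * δL) * c.κ * d) ≤ 1 * (1 / 2) * 1 :=
        mul_le_mul (mul_le_mul ht1 hP2 hP0.le zero_le_one) hdec (Real.exp_pos _).le (by norm_num)
      _ = 1 / 2 := by ring

/-! ## §2. One record per block size `L ≥ L₀`, serving every bond-cube side `M` -/

/-- **THE LEMMA-3 WITNESS AT EVERY BLOCK SIZE `L ≥ L₀` AND EVERY BOND-CUBE SIDE `M ≥ 1`.**  A threshold `L₀ ≥ 8`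
and letters `a₂, a₂′, a₅, Aabs, Bc` such that for EVERY `L ≥ L₀` ONE record `c` with `c.L = L` satisfies, for every
`M ≥ 1` at an `M`-dependent rate, the 41 conjuncts of `numerics_nonvacuous_pos` VERBATIM (T45 `lemma3_witness_allM`
composed with §1; `L₀` = T45's `c.L`).  Print's shape: the block size is the producer's, fixed first ([I] p. 251
*"L is an odd, positive integer > 11"*), the constants are fixed after it (p. 21 *"The assumptions allow finally us to
fix all the constants"*).  Consistency of the typed list, not the size of Bałaban's constants.
[cite: Balaban1987RG1, p.251; Balaban1988RG2Cluster, p.21 (closing paragraph), (2.31) p.18, (2.18) p.16] -/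
theorem lemma3_witness_allL :
    ∃ (L₀ : ℕ) (a₂ a₂' a₅ Aabs Bc : ℝ), 8 ≤ L₀ ∧ ∀ L : ℕ, L₀ ≤ L → ∃ c : B13.Consts, c.L = L ∧
      ∀ M : ℕ, 0 < M → ∃ a : ℝ,
      8 ≤ c.L ∧ 0 < M ∧ 0 < c.ε₁ ∧ 0 < c.α₆ ∧ 0 ≤ c.eps2 ∧ 0 ≤ c.δ ∧ 0 ≤ 1 - 7 * c.δ ∧ 0 ≤ c.κ ∧ 0 ≤ a ∧
      c.R15 ∧ 18 * ((1 - 4 * c.δ) * c.κ) ≤ a / 20 ∧ 4 * c.κ ≤ a / 20 ∧ Real.exp (-(a / 20)) ≤ c.eps2 ∧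
      2 * (4 : ℝ) * (M : ℝ) ^ 4 * Real.exp (-(a / 10)) ≤ a / 20 ∧
      0 ≤ a₂ ∧ kappa₀ 64 8 + a₂ ≤ c.δ * c.κ ∧ c.α₆ * Real.exp a₂ * K₀ 64 8 * 64 ≤ a₂ ∧
      Real.exp (-(a / 20)) * 64 ≤ c.δ * c.κ ∧
      B13Step237.R18half c (K₀ 64 8 * Real.exp (Real.exp (-(a / 20)) * 64)) ∧
      B13Step237.R18sharp c (K₀ 64 8 * Real.exp (Real.exp (-(a / 20)) * 64)) ((c.L : ℝ) / 2) ∧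
      0 ≤ a₂' ∧ kappa₀ 64 8 + a₂' ≤ c.δ * ((c.L : ℝ) / 2) * c.κ ∧ c.α₆ * Real.exp a₂' * K₀ 64 8 * 64 ≤ a₂' ∧
      18 * ((1 - 7 * c.δ) * ((c.L : ℝ) / 2) * c.κ) ≤ (c.κ₁ - 1) / 2 ∧
      0 ≤ a₅ ∧ a₅ + Real.exp (-((c.κ₁ - 1) / 2)) ≤ Aabs ∧ Aabs * 64 ≤ c.δ * ((c.L : ℝ) / 2) * c.κ ∧
      B13Step237.bracketF c (K₀ 64 8 * Real.exp (Real.exp (-(a / 20)) * 64)) / c.α₆ * Real.exp (Aabs * 64) ≤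
        c.C3act * c.ε₁ ∧
      0 ≤ c.C3act * c.ε₁ ∧ c.κ + 2 * (64 * Real.log 162) + 2 ≤ (1 - 8 * c.δ) * ((c.L : ℝ) / 2) * c.κ ∧
      c.C3act * c.ε₁ * Real.exp (5 * c.κ + 1) * K₀ 64 8 * 9 * 64 ≤ 1 ∧
      Real.exp 1 * 9 * 64 * K₀ 64 8 ^ 2 ≤ c.A₂ ∧ c.R22 ∧ c.R23 ∧ c.R24sharp ∧ 0 ≤ c.E₀ ∧
      0 ≤ Bc ∧ Bc * 64 ≤ c.E₀ / 2 ∧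
      0 < a₅ ∧ 1 ≤ c.κ₁ ∧
      (∀ d : ℝ, 0 ≤ d → 0 < invTau c d ∧ invTau c d ≤ 1 / 2) := by
  obtain ⟨c, a₂, a₂', a₅, Aabs, Bc, hc⟩ := lemma3_witness_allM
  obtain ⟨-, hL, -⟩ := hc 1 Nat.one_pos
  refine ⟨c.L, a₂, a₂', a₅, Aabs, Bc, hL, fun L hLL => ?_⟩
  obtain ⟨c', hc'L, -, -, htr⟩ := lemma3_witness_transfer c hLL
  refine ⟨c', hc'L, fun M hM => ?_⟩
  obtain ⟨a, h⟩ := hc M hM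
  exact htr h

end Summit.QuantumFields.BalabanUV.T4Continuum.Spine.NE5.TwoRunTorusNE5AllL

end
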